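import Literature.AnabelianGeometry.EtaleTheta.Discharge.Sec2Lem217iiClosureRefuted
import HarnessLib

/-!
# [EtTh] Lemma 2.17 (ii) as typed (`TemperedCoverData.Lem217_ii`, FACT-LIST F-0606): a NECESSARY CONDITION on the
# carrier — the image of `Π^tp_Y` in `Π_C` must NOT be closed; hence the row fails at every carrier whose `Π^tp_Y`
# is compact (proof-only companion of `ThetaCoversTempered.lean`; 0 definitions)

S. Mochizuki, *The étale theta function and its Frobenioid-theoretic manifestations* [EtTh], Publ. RIMS **45**
(2009), §2, Lemma 2.17 (ii), PRIMS PDF p. 58 [cite: MochizukiEtTh2009, Lem 2.17(ii) p.58]: «for `Π` the tempered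
fundamental group of a hyperbolic orbicurve over a finite extension of `ℚ_p` and `H ⊆ Π` an open subgroup,
`N_{Π̂}(H) = N_Π(H)`». The typer (abc-iut-L2-t2) records it for `Π = Π^tp_C ↪ Π_C`:
`T.Lem217_ii := ∀ H open in Π^tp_C, N_{Π_C}(toHat H) = toHat(N_{Π^tp_C}(H))`.

Cell abc-iut, block F (instance-form wave INST59, KEY INST59J1 row F-0606), seat abc-iut-f-108 (gen 4). The row asks
for an INSTANCE (a carrier `T : TemperedCoverData l` at which the typed sentence holds). abc-iut-f-142
(`Discharge/Sec2Lem217iiClosureRefuted.lean`) showed it FAILS at every carrier with DISCRETE countably infinite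
`Π^tp_C` (`H = 1` is open). THIS file sharpens the obstruction to a test every carrier in the tree fails, and thereby
SIZES what a serving carrier must be (pure topology/group theory over the interface):
* `normalizer_eq_top_of_isClosed` — a CLOSED subgroup of `Π_C` normalised by the dense image of `Π^tp_C` is normal;
* `toHat_surjective_of_lem217_ii_of_isClosed` — if the image `toHat(Π^tp_Y)` is closed in `Π_C`, the typed
  Lemma 2.17 (ii) at the open normal subgroup `H := Π^tp_Y` forces `Π^tp_C → Π_C` to be ONTO;
* `not_lem217_ii_of_isClosed_map_PiYtp` — … which is absurd: `Π_X / toHat(Π^tp_Y) ≅ Π^tp_X/Π^tp_Y ≅ ℤ` would be a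
  countably infinite compact Hausdorff group (Baire; abc-iut-w6-d028's `not_surjective_of_injective_of_compactSpace`);
* `not_lem217_ii_of_isCompact_PiYtp`, `lem217_ii_imp_not_isCompact_PiYtp` — **every carrier with COMPACT `Π^tp_Y`
  refutes the row**; a serving carrier must have a NON-compact (in particular infinite, non-discrete is not enough)
  `Π^tp_Y` densely but non-closedly embedded — as the genuine tempered `Π^tp_Y` is (it has infinite discrete
  quotients: the combinatorial coverings of the chain `Y`). The toy carriers in the tree have FINITE `Π^tp_Y`
  (`(ℤ/l)² × ℤ/2`-like); the setting-born covers (`ThetaCoversTemperedOfSetting.lean`) have `Π^tp_Y = inclX(Ker toZ)`,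
  compact whenever `Ker toZ` is (e.g. `Ker(F̂₂ ×_Ẑ ℤ → ℤ) ⋊ G_{ℚ_p}` at `modelχ`) — that case is NOT kernel-checked here.
HONEST FRAMING: statements about OUR typed sentence over OUR interface; refuted-as-typed-at-a-carrier ≠ refuted in
print (print's `Π` is the tempered `π₁` of a curve, where `Π^tp_Y` is indeed non-compact); typed ≠ proved; no side
is taken on [IUTchIII] Cor. 3.12 or on any author.
-/

noncomputable section

namespace Literature.AnabelianGeometry.EtaleTheta

namespace ThetaCovers

universe u

namespace TemperedCoverData

open Literature.AnabelianGeometry.SemiGraphs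

variable {l : ℕ} (T : TemperedCoverData.{u} l)

/-- **A closed subgroup of `Π_C` normalised by `toHat(Π^tp_C)` is normal**: the set of `g` conjugating `M` into
itself both ways is closed (continuity of conjugation, `M` closed) and contains the dense range of `toHat`
(`IsProfiniteCompletion.denseRange`). [cite: MochizukiEtTh2009, Lem 2.17(ii) p.58] -/
theorem normalizer_eq_top_of_isClosed {M : Subgroup T.PiC} (hM : IsClosed (M : Set T.PiC))
    (hnorm : ∀ x : T.Gtp, ∀ m ∈ M, T.toHat x * m * (T.toHat x)⁻¹ ∈ M) :
    Subgroup.normalizer (M : Set T.PiC) = ⊤ := by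
  -- the bi-normalising set is closed
  set S : Set T.PiC := {g | ∀ m ∈ M, g * m * g⁻¹ ∈ M ∧ g⁻¹ * m * g ∈ M} with hS
  have hSc : IsClosed S := by
    have : S = ⋂ m ∈ (M : Set T.PiC), ((fun g : T.PiC => g * m * g⁻¹) ⁻¹' (M : Set T.PiC)) ∩
        ((fun g : T.PiC => g⁻¹ * m * g) ⁻¹' (M : Set T.PiC)) := by
      ext g
      simp only [hS, Set.mem_setOf_eq, Set.mem_iInter, Set.mem_inter_iff, Set.mem_preimage, SetLike.mem_coe]
    rw [this]
    exact isClosed_biInter fun m _ =>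
      (hM.preimage (by fun_prop)).inter (hM.preimage (by fun_prop))
  -- it contains the dense range of `toHat`
  have hrange : Set.range T.toHat ⊆ S := by
    rintro _ ⟨x, rfl⟩ m hm
    refine ⟨hnorm x m hm, ?_⟩
    have h := hnorm x⁻¹ m hm
    rwa [map_inv, inv_inv] at h
  have hdense : DenseRange T.toHat := T.isProfiniteCompletion_toHat.denseRange
  have hall : ∀ g : T.PiC, g ∈ S := fun g => by
    have hg : g ∈ closure (Set.range T.toHat) := by rw [hdense.closure_range]; trivial
    exact hSc.closure_subset_iff.mpr hrange hg
  refine top_unique fun g _ => Subgroup.mem_normalizer_iff.mpr fun m => ⟨fun hm => (hall g m hm).1, fun hm => ?_⟩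
  have h := (hall g _ hm).2
  simpa [mul_assoc] using h

/-- The image `toHat(Π^tp_Y)` is normalised by `toHat(Π^tp_C)` (`Π^tp_Y ◁ Π^tp_C`).
[cite: MochizukiEtTh2009, Lem 2.17(ii) p.58] -/
theorem toHat_conj_mem_map_PiYtp (x : T.Gtp) (m : T.PiC) (hm : m ∈ T.PiYtp.map T.toHat) :
    T.toHat x * m * (T.toHat x)⁻¹ ∈ T.PiYtp.map T.toHat := by
  haveI := T.PiYtp_normal
  obtain ⟨y, hy, rfl⟩ := hm
  refine ⟨x * y * x⁻¹, T.PiYtp_normal.conj_mem y hy x, ?_⟩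
  rw [map_mul, map_mul, map_inv]

/-- **If `toHat(Π^tp_Y)` is closed in `Π_C`, the typed Lemma 2.17 (ii) forces `Π^tp_C ↠ Π_C`**: at the open normal
subgroup `H := Π^tp_Y`, `N_{Π_C}(toHat Π^tp_Y) = Π_C` (closed + normalised by a dense subgroup) while
`toHat(N_{Π^tp_C}(Π^tp_Y)) = toHat(Π^tp_C)`. [cite: MochizukiEtTh2009, Lem 2.17(ii) p.58] -/
theorem toHat_surjective_of_lem217_ii_of_isClosed (h : T.Lem217_ii)
    (hc : IsClosed ((T.PiYtp.map T.toHat : Subgroup T.PiC) : Set T.PiC)) : Function.Surjective T.toHat := by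
  haveI := T.PiYtp_normal
  have key := h T.PiYtp T.isOpen_PiYtp
  rw [T.normalizer_eq_top_of_isClosed hc (T.toHat_conj_mem_map_PiYtp),
    Subgroup.normalizer_eq_top (H := T.PiYtp), ← MonoidHom.range_eq_map] at key
  exact MonoidHom.range_eq_top.mp key.symm

/-- **`Π^tp_C → Π_C` is never onto when `toHat(Π^tp_Y)` is closed**: otherwise `toHat` induces a continuous group
ISOMORPHISM `ℤ ≅ Π^tp_X/Π^tp_Y → Π_X / toHat(Π^tp_Y)` onto a compact Hausdorff group — impossible for a countably
infinite group (Baire; abc-iut-w6-d028's `SemiGraphs.not_surjective_of_injective_of_compactSpace`).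
[cite: MochizukiEtTh2009, Lem 2.17(ii) p.58] -/
theorem toHat_not_surjective_of_isClosed (hc : IsClosed ((T.PiYtp.map T.toHat : Subgroup T.PiC) : Set T.PiC)) :
    ¬ Function.Surjective T.toHat := by
  intro hsurj
  haveI : CompactSpace T.PiC := T.isProfiniteCompletion_toHat.compactSpace
  haveI : T2Space T.PiC := T.isProfiniteCompletion_toHat.t2Space
  -- the closed image `M := toHat(Π^tp_Y)` is normal in `Π_C`
  set M : Subgroup T.PiC := T.PiYtp.map T.toHat with hMdef
  haveI hMn : M.Normal :=
    Subgroup.normalizer_eq_top_iff.mp (T.normalizer_eq_top_of_isClosed hc (T.toHat_conj_mem_map_PiYtp))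
  -- the compact group `Π_X` and its closed normal subgroup `M ∩ Π_X`
  haveI : CompactSpace T.PiX := isCompact_iff_compactSpace.mp (T.PiX.isClosed_of_isOpen T.isOpen_PiX).isCompact
  set N' : Subgroup T.PiX := M.subgroupOf T.PiX with hN'def
  haveI : N'.Normal := hMn.subgroupOf T.PiX
  haveI : IsClosed (N' : Set T.PiX) := hc.preimage continuous_subtype_val
  -- the source `Π^tp_X / Π^tp_Y ≅ ℤ`
  set G : Subgroup T.Gtp := T.PiX.comap T.toHat with hGdef
  set N : Subgroup G := T.PiYtp.subgroupOf G with hNdef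
  haveI : N.Normal := T.PiYtp_normal.subgroupOf G
  obtain ⟨e⟩ := T.quotZ
  -- `toHat` restricted to `Π^tp_X → Π_X`
  let ψ : G →* T.PiX := (T.toHat.comp G.subtype).codRestrict T.PiX fun x => x.2
  have hψN : N ≤ N'.comap ψ := by
    intro x hx
    exact ⟨(x : T.Gtp), hx, rfl⟩
  let φ : G ⧸ N →* T.PiX ⧸ N' := QuotientGroup.map N N' ψ hψN
  -- `φ` is injective: `toHat x ∈ toHat(Π^tp_Y)` forces `x ∈ Π^tp_Y`
  have hφinj : Function.Injective φ := by
    refine (MonoidHom.ker_eq_bot_iff φ).mp ?_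
    rw [QuotientGroup.ker_map, ← le_bot_iff]
    rintro _ ⟨x, hx, rfl⟩
    obtain ⟨y, hy, hyx⟩ := hx
    have hxy : (x : T.Gtp) = y := (T.injective_toHat hyx).symm
    rw [Subgroup.mem_bot, QuotientGroup.mk'_apply, QuotientGroup.eq_one_iff]
    show (x : T.Gtp) ∈ T.PiYtp
    rw [hxy]; exact hy
  -- `φ` is surjective because `toHat` is
  have hφsurj : Function.Surjective φ := by
    intro q
    induction q using QuotientGroup.induction_on with
    | H z =>
      obtain ⟨x, hx⟩ := hsurj (z : T.PiC)
      have hxG : x ∈ G := by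
        show T.toHat x ∈ T.PiX
        rw [hx]; exact z.2
      refine ⟨QuotientGroup.mk ⟨x, hxG⟩, ?_⟩
      rw [← QuotientGroup.mk'_apply, QuotientGroup.map_mk']
      congr 1
      exact Subtype.ext hx
  -- assemble the continuous bijection `ℤ → Π_X / M`
  haveI : Countable (Multiplicative ℤ) := inferInstanceAs (Countable ℤ)
  let f : Multiplicative ℤ →ₜ* T.PiX ⧸ N' :=
    { φ.comp e.symm.toMonoidHom with continuous_toFun := continuous_of_discreteTopology }
  refine not_surjective_of_injective_of_compactSpace f ?_ ?_
  · exact hφinj.comp e.symm.injective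
  · exact hφsurj.comp e.symm.surjective

/-- **F-0606 NECESSARY CONDITION.** If the image of `Π^tp_Y` in `Π_C` is closed, the typed Lemma 2.17 (ii)
FAILS at `T`. [cite: MochizukiEtTh2009, Lem 2.17(ii) p.58] -/
theorem not_lem217_ii_of_isClosed_map_PiYtp
    (hc : IsClosed ((T.PiYtp.map T.toHat : Subgroup T.PiC) : Set T.PiC)) :
    ¬ Literature.AnabelianGeometry.EtaleTheta.ThetaCovers.TemperedCoverData.Lem217_ii T := fun h =>
  T.toHat_not_surjective_of_isClosed hc (T.toHat_surjective_of_lem217_ii_of_isClosed h hc)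

/-- **Every carrier with COMPACT `Π^tp_Y` refutes F-0606 as typed** (the continuous image of a compact set in the
Hausdorff `Π_C` is closed). This covers the toy carriers of `TemperedCoverData` in the tree (finite `Π^tp_Y`) and
any setting-born cover whose `Ker toZ` is compact.
[cite: MochizukiEtTh2009, Lem 2.17(ii) p.58] -/
theorem not_lem217_ii_of_isCompact_PiYtp (hK : IsCompact (T.PiYtp : Set T.Gtp)) :
    ¬ Literature.AnabelianGeometry.EtaleTheta.ThetaCovers.TemperedCoverData.Lem217_ii T := by
  haveI : T2Space T.PiC := T.isProfiniteCompletion_toHat.t2Space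
  refine T.not_lem217_ii_of_isClosed_map_PiYtp ?_
  have : ((T.PiYtp.map T.toHat : Subgroup T.PiC) : Set T.PiC) = T.toHat '' (T.PiYtp : Set T.Gtp) :=
    Subgroup.coe_map _ _
  rw [this]
  exact (hK.image T.continuous_toHat).isClosed

/-- **What a serving carrier must look like**: at any `T` where the typed Lemma 2.17 (ii) holds, `Π^tp_Y` is NOT
compact (and its image in `Π_C` is dense in an open subgroup but not closed) — as for the genuine tempered
fundamental group of the chain `Y`, which has infinite discrete quotients. [cite: MochizukiEtTh2009, Lem 2.17(ii) p.58] -/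
theorem lem217_ii_imp_not_isCompact_PiYtp
    (h : Literature.AnabelianGeometry.EtaleTheta.ThetaCovers.TemperedCoverData.Lem217_ii T) :
    ¬ IsCompact (T.PiYtp : Set T.Gtp) := fun hK =>
  T.not_lem217_ii_of_isCompact_PiYtp hK h

end TemperedCoverData

end ThetaCovers

end Literature.AnabelianGeometry.EtaleTheta

end
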